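import Summits.AtomisticToContinuum.Crystallization.Theorems.OverbindingBudgetAffineFarTailDriftDecay
import Summits.AtomisticToContinuum.Crystallization.Theorems.OverbindingBudgetAffineFarCorePricingCluster

/-!
# Overbinding budget — slot Z of the 31280 record, leaf Z3a `TailDriftBound`: part 2, TRUNCATION, the matched decay sum, the pair estimate

The three estimates assembled in part 3 (`…OverbindingBudgetAffineFarTailDrift`) into `tailDriftBound_holds : TailDriftBound (1/25) (1/2000)`:

* §1 `refTail_le_sum_matched` — UNMATCHED STRUCTURE POINTS ARE FREE: every reference tail summand is `≤ 0` (`c.nn ≥ 9/10`), so the summable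
  series `refTail c` is at most its finite partial sum over the injective image `π(M)` of a matching;
* §2 `matched_decay_sum` — `Σ_{k ∈ M, π k ≠ 0} (a₀‖B(π k)‖)⁻⁴ ≤ 700`: the predictions `a₀ • B(π k)` are `(11/14) c.nn`-separated
  (part Z1 `ChartAdmissible.sep`) of norm `≥ c.nn`, and part 1's dyadic decay sum applies;
* §3 `tail_pair_estimate` — a pure real-variable estimate: for `|ν − nn| ≤ Cε₁ nn`, `|ρ − r| ≤ τ ≤ min (Dε₁ nn (1 + (r/nn)²)) (nn/4)`,
  `0.956 ≤ nn ≤ 2`, `Cε₁ ≤ 1/100`:  `tailW ν ρ · V ρ − tailW nn r · V r ≤ 40000 (C + D) ε₁ r⁻⁴`  (below `4 nn` both weights vanish; above,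
  `|ΔV| ≤ 256 τ / r⁷` and `|Δ tailW| · |V r| ≤ 114307 (τ + r Cε₁)/ν · 1/(4 r⁶)`, the quadratic growth of `τ` absorbed by the decay).

[this file: Summit.AtomisticToContinuum.Crystallization, slot Z of the 31280 record, leaf Z3a part 2]
-/

namespace Summit.AtomisticToContinuum.Crystallization.Theorems.OverbindingBudgetAffineFarSmoothSplit

open Literature.MathematicalPhysics.StatisticalMechanics
open Literature.Geometry.DiscreteGeometry
open scoped Classical

variable {N : ℕ}

/-! ## §1  Unmatched structure points are free -/

/-- **Truncation of the reference tail to a matching**: for a `1/25`-admissible chart with `c.nn ≥ 9/10` and an injective map `π : M → 𝓛(c.s)`,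
`refTail c ≤ ½ Σ_{k∈M} tailW(c.nn, a₀‖B(π k)‖) · V(a₀‖B(π k)‖)` (the omitted summands are `≤ 0`, the series is summable by admissibility).
[this file] -/
theorem refTail_le_sum_matched {c : Chart} (hadm : ChartAdmissible (1 / 25) c) (hν : 9 / 10 ≤ c.nn) {M : Finset (Fin N)}
    {π : Fin N → EuclideanSpace ℝ (Fin 3)} (hinj : Set.InjOn π ↑M) (hπ : ∀ k ∈ M, π k ∈ barlowStacking 1 (Real.sqrt (2 / 3)) c.s) :
    refTail c ≤ 1 / 2 * ∑ k ∈ M, tailW c.nn (c.a₀ * ‖c.B (π k)‖) * lennardJones (c.a₀ * ‖c.B (π k)‖) := by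
  set L := barlowStacking 1 (Real.sqrt (2 / 3)) c.s with hL
  set G : EuclideanSpace ℝ (Fin 3) → ℝ := fun x => tailW c.nn (c.a₀ * ‖c.B x‖) * lennardJones (c.a₀ * ‖c.B x‖) with hG
  set f : ↥L → ℝ := fun q => G (q : EuclideanSpace ℝ (Fin 3)) with hf
  have hsum : Summable f := summable_refTail hadm
  set s : Finset ↥L := (M.image π).subtype (· ∈ L) with hs
  have h1 : ∑ q ∈ s, f q + ∑' q : ↑((↑s : Set ↥L)ᶜ), f (q : ↥L) = ∑' q : ↥L, f q := hsum.sum_add_tsum_compl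
  have h2 : ∑' q : ↑((↑s : Set ↥L)ᶜ), f (q : ↥L) ≤ 0 := tsum_nonpos fun q => tailW_mul_lennardJones_nonpos hν
  have hall : ∀ x ∈ M.image π, x ∈ L := by
    intro x hx
    obtain ⟨k, hk, rfl⟩ := Finset.mem_image.mp hx
    exact hπ k hk
  have h3 : ∑ q ∈ s, f q = ∑ k ∈ M, G (π k) := by
    show ∑ q ∈ (M.image π).subtype (· ∈ L), G (q : EuclideanSpace ℝ (Fin 3)) = ∑ k ∈ M, G (π k)
    rw [Finset.sum_subtype_eq_sum_filter, Finset.filter_true_of_mem hall, Finset.sum_image hinj]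
  have e : refTail c = 1 / 2 * ∑' q : ↥L, f q := rfl
  rw [e, ← h1, h3]
  linarith

/-! ## §2  The matched decay sum -/

/-- **`Σ_{k ∈ M, π k ≠ 0} (a₀‖B(π k)‖)⁻⁴ ≤ 700`** for an injective `π : M → 𝓛(c.s)` of a `1/25`-admissible chart with `c.nn ≥ 9/10`: the points
`a₀ • B(π k)` are pairwise `(11/14) c.nn`-separated and of norm `≥ c.nn`, so part 1's decay sum gives `2 (56/11 + 1)³ (10/9)⁴ ≤ 700`. [this file] -/
theorem matched_decay_sum {c : Chart} (hadm : ChartAdmissible (1 / 25) c) (hν : 9 / 10 ≤ c.nn) {M : Finset (Fin N)}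
    {π : Fin N → EuclideanSpace ℝ (Fin 3)} (hinj : Set.InjOn π ↑M) (hπ : ∀ k ∈ M, π k ∈ barlowStacking 1 (Real.sqrt (2 / 3)) c.s) :
    ∑ k ∈ M.filter (fun k => π k ≠ 0), (c.a₀ * ‖c.B (π k)‖)⁻¹ ^ 4 ≤ 700 := by
  have ha₀ := hadm.2.1
  have hB := (near_iso_bounds hadm.2.2.2.1).1
  set M' := M.filter (fun k => π k ≠ 0) with hM'
  set Φ : Fin N → EuclideanSpace ℝ (Fin 3) := fun k => c.a₀ • c.B (π k) with hΦ
  have hnorm : ∀ k, ‖Φ k‖ = c.a₀ * ‖c.B (π k)‖ := fun k => by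
    simp only [hΦ]; rw [norm_smul, Real.norm_of_nonneg ha₀.le]
  have hπinj : ∀ k ∈ M', ∀ k' ∈ M', Φ k = Φ k' → k = k' := by
    intro k hk k' hk' h
    obtain ⟨hkM, -⟩ := Finset.mem_filter.mp hk
    obtain ⟨hk'M, -⟩ := Finset.mem_filter.mp hk'
    have h1 : c.B (π k) = c.B (π k') := smul_right_injective (EuclideanSpace ℝ (Fin 3)) ha₀.ne' h
    have h2 : π k = π k' := by
      by_contra hne
      have h3 : 22 / 25 * ‖π k - π k'‖ ≤ ‖c.B (π k - π k')‖ := hB _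
      rw [map_sub, h1, sub_self, norm_zero] at h3
      have h4 : 0 < ‖π k - π k'‖ := norm_pos_iff.mpr (sub_ne_zero.mpr hne)
      linarith
    exact hinj (Finset.mem_coe.mpr hkM) (Finset.mem_coe.mpr hk'M) h2
  have hΦinj : Set.InjOn Φ ↑M' := fun k hk k' hk' h => hπinj k (Finset.mem_coe.mp hk) k' (Finset.mem_coe.mp hk') h
  have e1 : ∑ k ∈ M', (c.a₀ * ‖c.B (π k)‖)⁻¹ ^ 4 = ∑ x ∈ M'.image Φ, ‖x‖⁻¹ ^ 4 := by
    rw [Finset.sum_image hΦinj]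
    exact Finset.sum_congr rfl fun k _ => by rw [hnorm]
  rw [e1]
  have hA : ∀ x ∈ M'.image Φ, c.nn ≤ ‖x‖ := by
    intro x hx
    obtain ⟨k, hk, rfl⟩ := Finset.mem_image.mp hx
    obtain ⟨hkM, hk0⟩ := Finset.mem_filter.mp hk
    rw [hnorm]
    exact hadm.2.2.2.2.1 (π k) (hπ k hkM) hk0
  have hsep : ∀ x ∈ M'.image Φ, ∀ x' ∈ M'.image Φ, x ≠ x' → 11 / 14 * c.nn ≤ dist x x' := by
    intro x hx x' hx' hne
    obtain ⟨k, hk, rfl⟩ := Finset.mem_image.mp hx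
    obtain ⟨k', hk', rfl⟩ := Finset.mem_image.mp hx'
    have hne' : π k ≠ π k' := fun h => hne (by simp only [hΦ, h])
    exact hadm.sep (hπ k (Finset.mem_filter.mp hk).1) (hπ k' (Finset.mem_filter.mp hk').1) hne'
  have h := separated_inv_pow_four_sum_le (M'.image Φ) (s := 11 / 14 * c.nn) (a := c.nn) (by positivity) (by linarith) hA hsep
  have e2 : 4 * c.nn / (11 / 14 * c.nn) = 56 / 11 := by
    rw [div_eq_iff (by positivity)]; ring
  rw [e2] at h
  have h1 : c.nn⁻¹ ^ 4 ≤ (9 / 10 : ℝ)⁻¹ ^ 4 :=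
    pow_le_pow_left₀ (inv_nonneg.mpr (by linarith)) (inv_anti₀ (by norm_num) hν) 4
  have h2 : 2 * (56 / 11 + 1 : ℝ) ^ 3 * c.nn⁻¹ ^ 4 ≤ 2 * (56 / 11 + 1) ^ 3 * (9 / 10 : ℝ)⁻¹ ^ 4 :=
    mul_le_mul_of_nonneg_left h1 (by positivity)
  have h3 : 2 * (56 / 11 + 1 : ℝ) ^ 3 * (9 / 10 : ℝ)⁻¹ ^ 4 ≤ 700 := by norm_num
  linarith

/-! ## §3  The pair estimate -/

/-- The relative-distance difference of a matched pair: `|ρ/ν − r/nn| ≤ (τ + r·K_C)/ν` for `|ρ − r| ≤ τ`, `|ν − nn| ≤ K_C·nn`. [this file] -/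
theorem abs_ratio_sub_ratio_le {ν nn ρ r τ KC : ℝ} (hν0 : 0 < ν) (hnn0 : 0 < nn) (hr0 : 0 ≤ r) (hρr : |ρ - r| ≤ τ)
    (hν : |ν - nn| ≤ KC * nn) : |ρ / ν - r / nn| ≤ (τ + r * KC) / ν := by
  have e : ρ / ν - r / nn = ((ρ - r) * nn + r * (nn - ν)) / (ν * nn) := by
    field_simp
    ring
  rw [e, abs_div, abs_of_pos (by positivity : 0 < ν * nn), div_le_div_iff₀ (by positivity) hν0]
  have h5 : |nn - ν| ≤ KC * nn := by rw [abs_sub_comm]; exact hν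
  have h4 : |(ρ - r) * nn + r * (nn - ν)| ≤ τ * nn + r * (KC * nn) :=
    calc |(ρ - r) * nn + r * (nn - ν)| ≤ |(ρ - r) * nn| + |r * (nn - ν)| := abs_add_le _ _
      _ = |ρ - r| * nn + r * |nn - ν| := by rw [abs_mul, abs_mul, abs_of_pos hnn0, abs_of_nonneg hr0]
      _ ≤ τ * nn + r * (KC * nn) := add_le_add (mul_le_mul_of_nonneg_right hρr hnn0.le) (mul_le_mul_of_nonneg_left h5 hr0)
  calc |(ρ - r) * nn + r * (nn - ν)| * ν ≤ (τ * nn + r * (KC * nn)) * ν := mul_le_mul_of_nonneg_right h4 hν0.le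
    _ = (τ + r * KC) * (ν * nn) := by ring

/-- **Term (a)** — the potential difference with decay: for `r ≥ 19/5`, `ρ ≥ r/2`, `|ρ − r| ≤ τ ≤ K_D (2 + 1.1 r²)`:
`tailW ν ρ · (V ρ − V r) ≤ 100 K_D r⁻⁴`. [this file] -/
theorem tail_term_a_le {ν ρ r τ KD : ℝ} (hr : 19 / 5 ≤ r) (hρ : r / 2 ≤ ρ) (hρr : |ρ - r| ≤ τ) (hKD : 0 ≤ KD)
    (hτ : τ ≤ KD * (2 + 11 / 10 * r ^ 2)) : tailW ν ρ * (lennardJones ρ - lennardJones r) ≤ 100 * KD * r⁻¹ ^ 4 := by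
  have hr0 : 0 < r := by linarith
  have h1 : tailW ν ρ * (lennardJones ρ - lennardJones r) ≤ |lennardJones ρ - lennardJones r| :=
    calc tailW ν ρ * (lennardJones ρ - lennardJones r) ≤ tailW ν ρ * |lennardJones ρ - lennardJones r| :=
          mul_le_mul_of_nonneg_left (le_abs_self _) (tailW_nonneg ν ρ)
      _ ≤ 1 * |lennardJones ρ - lennardJones r| := mul_le_mul_of_nonneg_right (tailW_le_one ν ρ) (abs_nonneg _)
      _ = |lennardJones ρ - lennardJones r| := one_mul _
  have h2 := abs_lennardJones_sub_le_decay (by linarith : (2 : ℝ) ≤ r) hρ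
  have h3 : 256 * |ρ - r| / r ^ 7 ≤ 256 * (KD * (2 + 11 / 10 * r ^ 2)) / r ^ 7 :=
    div_le_div_of_nonneg_right (mul_le_mul_of_nonneg_left (hρr.trans hτ) (by norm_num)) (by positivity)
  have h4 : 256 * (KD * (2 + 11 / 10 * r ^ 2)) / r ^ 7 ≤ 100 * KD * r⁻¹ ^ 4 := by
    rw [inv_pow, ← div_eq_mul_inv, div_le_div_iff₀ (by positivity) (by positivity)]
    have h5 : 256 * (2 + 11 / 10 * r ^ 2) ≤ 100 * r ^ 3 := by nlinarith
    have h6 : 0 ≤ KD * r ^ 4 := by positivity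
    have h7 := mul_le_mul_of_nonneg_left h5 h6
    have e1 : 256 * (KD * (2 + 11 / 10 * r ^ 2)) * r ^ 4 = KD * r ^ 4 * (256 * (2 + 11 / 10 * r ^ 2)) := by ring
    have e2 : 100 * KD * r ^ 7 = KD * r ^ 4 * (100 * r ^ 3) := by ring
    rw [e1, e2]; exact h7
  linarith

/-- The numeric heart of term (b): `28576.7 (τ + r K_C) ≤ (39900 K_D + 40000 K_C) ν r²` for `r ≥ 19/5`, `ν ≥ 473/500`,
`τ ≤ K_D (2 + 1.1 r²)`. [this file] -/
theorem tail_term_b_key {ν r τ KC KD : ℝ} (hr : 19 / 5 ≤ r) (hν : 473 / 500 ≤ ν) (hKC : 0 ≤ KC) (hKD : 0 ≤ KD)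
    (hτ : τ ≤ KD * (2 + 11 / 10 * r ^ 2)) :
    491520 * (10 / 43) * (1 / 4) * (τ + r * KC) ≤ (39900 * KD + 40000 * KC) * (ν * r ^ 2) := by
  have hr2 : 361 / 25 ≤ r ^ 2 := by nlinarith
  have hνr : 473 / 500 * r ^ 2 ≤ ν * r ^ 2 := mul_le_mul_of_nonneg_right hν (sq_nonneg r)
  have k1 : 491520 * (10 / 43) * (1 / 4) * (2 + 11 / 10 * r ^ 2) ≤ 39900 * (473 / 500 * r ^ 2) := by nlinarith
  have k2 : 491520 * (10 / 43) * (1 / 4) * r ≤ 40000 * (473 / 500 * r ^ 2) := by nlinarith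
  have k3 : 491520 * (10 / 43) * (1 / 4) * τ ≤ KD * (39900 * (ν * r ^ 2)) :=
    calc 491520 * (10 / 43) * (1 / 4) * τ ≤ 491520 * (10 / 43) * (1 / 4) * (KD * (2 + 11 / 10 * r ^ 2)) :=
          mul_le_mul_of_nonneg_left hτ (by norm_num)
      _ = KD * (491520 * (10 / 43) * (1 / 4) * (2 + 11 / 10 * r ^ 2)) := by ring
      _ ≤ KD * (39900 * (473 / 500 * r ^ 2)) := mul_le_mul_of_nonneg_left k1 hKD
      _ ≤ KD * (39900 * (ν * r ^ 2)) := mul_le_mul_of_nonneg_left (by linarith) hKD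
  have k4 : 491520 * (10 / 43) * (1 / 4) * (r * KC) ≤ KC * (40000 * (ν * r ^ 2)) :=
    calc 491520 * (10 / 43) * (1 / 4) * (r * KC) = KC * (491520 * (10 / 43) * (1 / 4) * r) := by ring
      _ ≤ KC * (40000 * (473 / 500 * r ^ 2)) := mul_le_mul_of_nonneg_left k2 hKC
      _ ≤ KC * (40000 * (ν * r ^ 2)) := mul_le_mul_of_nonneg_left (by linarith) hKC
  have e : 491520 * (10 / 43) * (1 / 4) * (τ + r * KC) = 491520 * (10 / 43) * (1 / 4) * τ + 491520 * (10 / 43) * (1 / 4) * (r * KC) := by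
    ring
  rw [e]
  linarith

/-- **Term (b)** — the weight difference against the potential: with `|ρ/ν − r/nn| ≤ (τ + r K_C)/ν` (from `abs_ratio_sub_ratio_le`), `r ≥ 19/5`,
`ν ≥ 473/500`, `τ ≤ K_D (2 + 1.1 r²)`:  `(tailW ν ρ − tailW nn r) · V r ≤ (39900 K_D + 40000 K_C) r⁻⁴`. [this file] -/
theorem tail_term_b_le {ν nn ρ r τ KC KD : ℝ} (hr : 19 / 5 ≤ r) (hν : 473 / 500 ≤ ν) (hKC : 0 ≤ KC) (hKD : 0 ≤ KD)
    (hτ : τ ≤ KD * (2 + 11 / 10 * r ^ 2)) (hratio : |ρ / ν - r / nn| ≤ (τ + r * KC) / ν) :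
    (tailW ν ρ - tailW nn r) * lennardJones r ≤ (39900 * KD + 40000 * KC) * r⁻¹ ^ 4 := by
  have hr0 : 0 < r := by linarith
  have hν0 : 0 < ν := by linarith
  have h1 : (tailW ν ρ - tailW nn r) * lennardJones r ≤ |tailW ν ρ - tailW nn r| * |lennardJones r| := by
    rw [← abs_mul]; exact le_abs_self _
  have h2 : |tailW ν ρ - tailW nn r| ≤ 491520 * (10 / 43) * ((τ + r * KC) / ν) :=
    (abs_tailW_sub_tailW_le ν ρ nn r).trans (mul_le_mul_of_nonneg_left hratio (by norm_num))
  have hV : |lennardJones r| ≤ 1 / (4 * r ^ 6) := by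
    have h := abs_lennardJones_mul_pow_six_le (by linarith : (1 : ℝ) ≤ r)
    rw [le_div_iff₀ (by positivity)]
    linarith
  have h5 : |tailW ν ρ - tailW nn r| * |lennardJones r| ≤ (491520 * (10 / 43) * ((τ + r * KC) / ν)) * (1 / (4 * r ^ 6)) :=
    mul_le_mul h2 hV (abs_nonneg _) (le_trans (abs_nonneg _) h2)
  have key := tail_term_b_key hr hν hKC hKD hτ
  have h6 : (491520 * (10 / 43) * ((τ + r * KC) / ν)) * (1 / (4 * r ^ 6)) ≤ (39900 * KD + 40000 * KC) * r⁻¹ ^ 4 := by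
    have e1 : (491520 * (10 / 43) * ((τ + r * KC) / ν)) * (1 / (4 * r ^ 6)) =
        (491520 * (10 / 43) * (τ + r * KC)) / (4 * ν * r ^ 6) := by
      field_simp
    rw [e1, inv_pow, ← div_eq_mul_inv, div_le_div_iff₀ (by positivity) (by positivity)]
    have h7 := mul_le_mul_of_nonneg_left key (by positivity : (0 : ℝ) ≤ 4 * r ^ 4)
    have e2 : 491520 * (10 / 43) * (τ + r * KC) * r ^ 4 = 4 * r ^ 4 * (491520 * (10 / 43) * (1 / 4) * (τ + r * KC)) := by ring
    have e3 : (39900 * KD + 40000 * KC) * (4 * ν * r ^ 6) = 4 * r ^ 4 * ((39900 * KD + 40000 * KC) * (ν * r ^ 2)) := by ring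
    rw [e2, e3]; exact h7
  linarith

/-- **The matched tail summands differ by `O((C + D) ε₁ r⁻⁴)`** (pure real variables): chart scale `ν` with `|ν − nn| ≤ Cε₁ nn`, structure
distance `ρ`, configuration distance `r` with `|ρ − r| ≤ τ`, `τ ≤ nn/4`, `τ ≤ Dε₁ nn (1 + (r/nn)²)`, at a normal site (`0.956 ≤ nn ≤ 2`,
`Cε₁ ≤ 1/100`):  `tailW ν ρ · V ρ − tailW nn r · V r ≤ 40000 (C + D) ε₁ r⁻⁴`  (below `4 nn` both weights vanish; above, terms (a) + (b)).
[this file] -/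
theorem tail_pair_estimate {C D ε₁ nn ν ρ r τ : ℝ} (hC : 0 ≤ C) (hD : 0 ≤ D) (hε₁ : 0 < ε₁) (hnn : 239 / 250 ≤ nn) (hnn2 : nn ≤ 2)
    (hCε : C * ε₁ ≤ 1 / 100) (hν : |ν - nn| ≤ C * ε₁ * nn) (hρr : |ρ - r| ≤ τ) (hτ4 : τ ≤ nn / 4)
    (hτD : τ ≤ D * ε₁ * nn * (1 + (r / nn) ^ 2)) :
    tailW ν ρ * lennardJones ρ - tailW nn r * lennardJones r ≤ 40000 * (C + D) * ε₁ * r⁻¹ ^ 4 := by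
  have hnn0 : 0 < nn := by linarith
  have hν' := abs_le.mp hν
  have hCε0 : 0 ≤ C * ε₁ := by positivity
  have hDε : 0 ≤ D * ε₁ := by positivity
  have hCεnn : C * ε₁ * nn ≤ 1 / 100 * nn := mul_le_mul_of_nonneg_right hCε hnn0.le
  have hν1 : 99 / 100 * nn ≤ ν := by linarith
  have hρr' := abs_le.mp hρr
  have hRHS : 0 ≤ 40000 * (C + D) * ε₁ * r⁻¹ ^ 4 := by positivity
  by_cases hr4 : r < 4 * nn
  · -- both weights vanish
    have h1 : tailW nn r = 0 := tailW_eq_zero hnn0 (by linarith)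
    have h2 : tailW ν ρ = 0 := tailW_eq_zero (by linarith) (by linarith)
    rw [h1, h2, zero_mul, zero_mul, sub_zero]; exact hRHS
  · push Not at hr4
    have hr38 : 19 / 5 ≤ r := by linarith
    have hr0 : 0 < r := by linarith
    have hρhalf : r / 2 ≤ ρ := by linarith
    have hν0 : 0 < ν := by linarith
    have hν946 : 473 / 500 ≤ ν := by linarith
    -- the tolerance in polynomial form
    have hτ' : τ ≤ D * ε₁ * (2 + 11 / 10 * r ^ 2) := by
      have e : D * ε₁ * nn * (1 + (r / nn) ^ 2) = D * ε₁ * (nn + r ^ 2 / nn) := by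
        rw [div_pow]; field_simp
      have h1 : r ^ 2 / nn ≤ 11 / 10 * r ^ 2 := by
        rw [div_le_iff₀ hnn0]; nlinarith [sq_nonneg r]
      have h2 : nn + r ^ 2 / nn ≤ 2 + 11 / 10 * r ^ 2 := by linarith
      rw [e] at hτD
      exact hτD.trans (mul_le_mul_of_nonneg_left h2 hDε)
    have e : tailW ν ρ * lennardJones ρ - tailW nn r * lennardJones r =
        tailW ν ρ * (lennardJones ρ - lennardJones r) + (tailW ν ρ - tailW nn r) * lennardJones r := by ring
    rw [e]
    have ha := tail_term_a_le (ν := ν) hr38 hρhalf hρr hDε hτ'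
    have hb := tail_term_b_le hr38 hν946 hCε0 hDε hτ' (abs_ratio_sub_ratio_le hν0 hnn0 hr0.le hρr hν)
    have e2 : 40000 * (C + D) * ε₁ * r⁻¹ ^ 4 = 100 * (D * ε₁) * r⁻¹ ^ 4 + (39900 * (D * ε₁) + 40000 * (C * ε₁)) * r⁻¹ ^ 4 := by
      ring
    rw [e2]
    exact add_le_add ha hb

end Summit.AtomisticToContinuum.Crystallization.Theorems.OverbindingBudgetAffineFarSmoothSplit
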